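import Summits.CriticalPhenomena.Ising3DConformalLimit.Theorems.FKParityRobustnessIndependentStrandsJoinUnionShadowFibre
import HarnessLib

/-!
# Crux IndependentStrandsJoin (stmt-CriticalPhenomena-14625) — the union-shadow identity

Route `FKParityRobustness`, sub-problem `Ising3DConformalLimit`; registered stub `stub_unionShadowIdentity`
of the line `union-shadow-exact` (skeleton `Cruxes/IndependentStrandsJoin/Lines/union_shadow_exact.lean`): the
EXACT loop-O(1) form of the Aizenman–Duminil-Copin deletion identity (Ann. of Math. 194 (2021), App. Lemma A.1 /
8.1), on every finite graph, for every `β`, every injective `a : Fin 4 → V`: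

`Σ_{F₁ ∈ 𝒯(a₀a₁)} Σ_{F₂ ∈ 𝒯(a₂a₃)} 1[a₀ ↮ a₂ in F₁ ∪ F₂] t^{|F₁|+|F₂|}
   = Σ_{F₂ ∈ 𝒯(a₂a₃)} Σ_{F₀ ∈ 𝒯(∅)} 1[a₀, a₁ ∉ C⁺] t^{|F₂|+|F₀|} ⟨σ_{a₀}σ_{a₁}⟩^free_{G ∖ C⁺}`,

`t = tanh β`, `C⁺ = {v : a₂ ↝ v in F₂ ∪ F₀}` (the UNION CLUSTER), `𝒯(A) = tJoins G univ A`.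

Proof (theorem-only file; the fibre decomposition is the LANDED helper file
`Theorems/FKParityRobustnessIndependentStrandsJoinUnionShadowFibre.lean` (aux stub `stub_unionShadowFibre`); the remaining
helpers live in the sub-namespace `StubUnionShadowIdentity`).  Fix the base `B = F₂` and
the root `x = a₂`; for an edge set `F` let `C_F = {v : x ↝_{B ∪ F} v}` and split `F = in(F) ⊔ out(F)`, `in(F)` =
the edges of `F` with an endpoint in `C_F` (then both endpoints are in `C_F`), `out(F)` = the edges of `F` off
`C_F`.  Then `C_{in(F)} = C_F` (`reach_inF_iff`), `in(F)` is an EVEN subgraph glued to its own cluster whenever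
the sources of `F` lie off `C_F`, and `out(F)` is a `T`-join with the SAME sources among the edges avoiding
`C_F`; conversely `I ⊔ O` recovers `F` (`reach_union_iff`).  Hence, for sources `A ⊆ S` required off the
cluster (`fibre_identity`):
`Σ_{F ∈ 𝒯(A), S ∩ C_F = ∅} g(F) = Σ_{I} Σ_{O ∈ 𝒯_{G − C_I}(A)} g(I ∪ O)` over the SAME index set of
inside parts `I` for every `A`.  With `A = S = {a₀,a₁}` (left side; `a₀ ∉ C` forces `a₁ ∉ C` because a
`T`-join of a pair joins its pair) the `O`-sum is `g_{Λ_I}({a₀,a₁})`, `Λ_I = V ∖ C_I`; with `A = ∅`,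
`S = {a₀,a₁}` (right side) it is `g_{Λ_I}(∅) · ⟨σ_{a₀}σ_{a₁}⟩^free_{Λ_I} = g_{Λ_I}({a₀,a₁})` by the
high-temperature expansion `isingCorr_free_eq_hteSum_div`.  Both sides agree fibrewise.

References: M. Aizenman, H. Duminil-Copin, Ann. of Math. 194 (2021), arXiv:1912.07973, App. A
[AizenmanDuminilCopinAnnals2021]; H. Duminil-Copin, lectures on the Ising and Potts models (2016/2018), §2.2.1
(high-temperature expansion) [DuminilCopinECM2018]; U. T. Hansen, J. Jiang, F. R. Klausen, arXiv:2506.10765 §2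
(sourced loop O(1)) [HansenJiangKlausen2025].
-/

noncomputable section

open Finset SimpleGraph
open Literature.Probability.LatticeModels
open Literature.Combinatorics.SimpleGraph.CycleSpace (edgeDeg exists_reachable_odd_of_odd)

namespace Summit.CriticalPhenomena.Ising3DConformalLimit.Theorems

open scoped Classical BigOperators

variable {V : Type*} [Fintype V] [DecidableEq V]

namespace StubUnionShadowIdentity

section OffSum

variable (G : SimpleGraph V) [DecidableRel G.Adj]

/-- The outside `T`-joins are the edge sets of the tree's `hteSum` over the complementary volume
`Λ = {v : ¬ R v}`: `tJoins G {e : ∀ w ∈ e, ¬ R w} A = {R' ⊆ ℰ_Λ : oddVerts Λ R' = A}` for `A ⊆ Λ`. -/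
theorem tJoins_off_eq (Rv : V → Prop) {A : Finset V} (hA : ∀ v ∈ A, ¬ Rv v) :
    tJoins G {e | ∀ w ∈ e, ¬ Rv w} A =
      (edgesIn G (Finset.univ.filter fun v => ¬ Rv v)).powerset.filter
        (fun R' => oddVerts (Finset.univ.filter fun v => ¬ Rv v) R' = A) := by
  ext R'
  rw [mem_tJoins, Finset.mem_filter, Finset.mem_powerset]
  constructor
  · rintro ⟨hRG, hRoff, hRodd⟩
    refine ⟨fun e he => ?_, ?_⟩
    · rw [mem_edgesIn_iff]
      exact ⟨mem_edgeFinset.1 (hRG he), fun v hv =>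
        Finset.mem_filter.2 ⟨Finset.mem_univ v, hRoff (Finset.mem_coe.2 he) v hv⟩⟩
    · ext v
      rw [oddVerts, Finset.mem_filter, Finset.mem_filter]
      constructor
      · rintro ⟨-, hodd⟩; exact (hRodd v).1 hodd
      · intro hvA; exact ⟨⟨Finset.mem_univ v, hA v hvA⟩, (hRodd v).2 hvA⟩
  · rintro ⟨hRE, hRodd⟩
    refine ⟨fun e he => mem_edgeFinset.2 (mem_edgesIn_iff.1 (hRE he)).1, fun e he v hv => ?_, fun v => ?_⟩
    · exact (Finset.mem_filter.1 ((mem_edgesIn_iff.1 (hRE (Finset.mem_coe.1 he))).2 v hv)).2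
    · constructor
      · intro hodd
        by_cases hv : Rv v
        · have h0 : #(R'.filter (v ∈ ·)) = 0 := by
            rw [Finset.card_eq_zero, Finset.filter_eq_empty_iff]
            intro e he hve
            exact (Finset.mem_filter.1 ((mem_edgesIn_iff.1 (hRE he)).2 v hve)).2 hv
          rw [h0] at hodd
          exact absurd hodd Nat.not_odd_zero
        · have : v ∈ oddVerts (Finset.univ.filter fun v => ¬ Rv v) R' :=
            Finset.mem_filter.2 ⟨Finset.mem_filter.2 ⟨Finset.mem_univ v, hv⟩, hodd⟩
          rwa [hRodd] at this
      · intro hvA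
        rw [← hRodd] at hvA
        exact (Finset.mem_filter.1 hvA).2

/-- Hence the outside sum of `t^{|O|}` is the tree's `hteSum` over the complementary volume. -/
theorem sum_off_eq_hteSum (Rv : V → Prop) {A : Finset V} (hA : ∀ v ∈ A, ¬ Rv v) (t : ℝ) :
    ∑ O ∈ tJoins G {e | ∀ w ∈ e, ¬ Rv w} A, t ^ #O = hteSum G (Finset.univ.filter fun v => ¬ Rv v) t A := by
  rw [tJoins_off_eq G Rv hA]
  rfl

end OffSum

section Assembly

variable (G : SimpleGraph V) [DecidableRel G.Adj] (B : Finset (Sym2 V)) (x : V)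

/-- For `I` in the index set and `O` an outside `T`-join: `O` avoids the cluster of `I`, and `I`, `O` are
disjoint. -/
theorem idx_out_avoid_disjoint {S A : Finset V} {I O : Finset (Sym2 V)}
    (hI : I ∈ (tJoins G Set.univ (∅ : Finset V)).filter fun (I : Finset (Sym2 V)) =>
        (I.filter fun e => ∃ w ∈ e, (fromEdgeSet ((↑B : Set (Sym2 V)) ∪ ↑I)).Reachable x w) = I ∧
        ∀ s ∈ S, ¬ (fromEdgeSet ((↑B : Set (Sym2 V)) ∪ ↑I)).Reachable x s)
    (hO : O ∈ tJoins G {e | ∀ w ∈ e, ¬ (fromEdgeSet ((↑B : Set (Sym2 V)) ∪ ↑I)).Reachable x w} A) :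
    (∀ e ∈ O, ∀ w ∈ e, ¬ (fromEdgeSet ((↑B : Set (Sym2 V)) ∪ ↑I)).Reachable x w) ∧ Disjoint I O := by
  obtain ⟨-, hIcl, -⟩ := Finset.mem_filter.1 hI
  obtain ⟨-, hOω, -⟩ := (mem_tJoins G).1 hO
  have havoid : ∀ e ∈ O, ∀ w ∈ e, ¬ (fromEdgeSet ((↑B : Set (Sym2 V)) ∪ ↑I)).Reachable x w :=
    fun e he w hw => hOω (Finset.mem_coe.2 he) w hw
  refine ⟨havoid, Finset.disjoint_left.2 fun e heI heO => ?_⟩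
  have heI' : e ∈ I.filter fun e => ∃ w ∈ e, (fromEdgeSet ((↑B : Set (Sym2 V)) ∪ ↑I)).Reachable x w := by
    rw [hIcl]; exact heI
  obtain ⟨-, w, hw, hrw⟩ := Finset.mem_filter.1 heI'
  exact havoid e heO w hw hrw

/-- **Both sides of the union-shadow identity, fibrewise.**  For a fixed base `B` (the configuration `F₂`)
rooted at `x = a₂`, a pair `{p, q}` of vertices and `t = tanh β`:
`Σ_{F ∈ 𝒯(pq), p,q ∉ C_F} t^{|F|} = Σ_{F ∈ 𝒯(∅), p,q ∉ C_F} t^{|F|} ⟨σ_pσ_q⟩^free_{V ∖ C_F}`. -/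
theorem pair_sum_eq_vacuum_sum (β : ℝ) (p q : V) :
    ∑ F ∈ (tJoins G Set.univ ({p, q} : Finset V)).filter
        (fun (F : Finset (Sym2 V)) => ∀ s ∈ ({p, q} : Finset V),
          ¬ (fromEdgeSet ((↑B : Set (Sym2 V)) ∪ ↑F)).Reachable x s),
      Real.tanh β ^ #F =
    ∑ F ∈ (tJoins G Set.univ (∅ : Finset V)).filter
        (fun (F : Finset (Sym2 V)) => ∀ s ∈ ({p, q} : Finset V),
          ¬ (fromEdgeSet ((↑B : Set (Sym2 V)) ∪ ↑F)).Reachable x s),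
      Real.tanh β ^ #F *
        isingCorr G (Finset.univ.filter fun v =>
          ¬ (fromEdgeSet ((↑B : Set (Sym2 V)) ∪ ↑F)).Reachable x v) β 0 .free {p, q} := by
  rw [fibre_identity G B x (A := {p, q}) (S := {p, q}) Finset.Subset.rfl,
    fibre_identity G B x (A := ∅) (S := {p, q}) (Finset.empty_subset _)]
  refine Finset.sum_congr rfl fun I hI => ?_
  have hIS : ∀ s ∈ ({p, q} : Finset V), ¬ (fromEdgeSet ((↑B : Set (Sym2 V)) ∪ ↑I)).Reachable x s :=
    (Finset.mem_filter.1 hI).2.2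
  set Λ : Finset V := Finset.univ.filter fun v => ¬ (fromEdgeSet ((↑B : Set (Sym2 V)) ∪ ↑I)).Reachable x v
    with hΛ
  have hpqΛ : ({p, q} : Finset V) ⊆ Λ := fun s hs =>
    Finset.mem_filter.2 ⟨Finset.mem_univ s, hIS s hs⟩
  -- left: `Σ_O t^{|I ∪ O|} = t^{|I|} · g_Λ({p,q})`
  have hL : ∑ O ∈ tJoins G {e | ∀ w ∈ e, ¬ (fromEdgeSet ((↑B : Set (Sym2 V)) ∪ ↑I)).Reachable x w} {p, q},
      Real.tanh β ^ #(I ∪ O) = Real.tanh β ^ #I * hteSum G Λ (Real.tanh β) {p, q} := by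
    rw [← sum_off_eq_hteSum G _ hIS, Finset.mul_sum]
    refine Finset.sum_congr rfl fun O hO => ?_
    rw [Finset.card_union_of_disjoint (idx_out_avoid_disjoint G B x hI hO).2, pow_add]
  -- right: `Σ_O t^{|I ∪ O|} ⟨σσ⟩_{Λ(I ∪ O)} = t^{|I|} · ⟨σσ⟩_Λ · g_Λ(∅) = t^{|I|} · g_Λ({p,q})`
  have hR : ∑ O ∈ tJoins G {e | ∀ w ∈ e, ¬ (fromEdgeSet ((↑B : Set (Sym2 V)) ∪ ↑I)).Reachable x w} ∅,
      Real.tanh β ^ #(I ∪ O) *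
        isingCorr G (Finset.univ.filter fun v =>
          ¬ (fromEdgeSet ((↑B : Set (Sym2 V)) ∪ ↑(I ∪ O))).Reachable x v) β 0 .free {p, q} =
      Real.tanh β ^ #I * hteSum G Λ (Real.tanh β) {p, q} := by
    have hvol : ∀ O ∈ tJoins G {e | ∀ w ∈ e, ¬ (fromEdgeSet ((↑B : Set (Sym2 V)) ∪ ↑I)).Reachable x w} ∅,
        (Finset.univ.filter fun v => ¬ (fromEdgeSet ((↑B : Set (Sym2 V)) ∪ ↑(I ∪ O))).Reachable x v) = Λ := by
      intro O hO
      have havoid := (idx_out_avoid_disjoint G B x hI hO).1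
      refine Finset.filter_congr fun v _ => ?_
      rw [reach_union_iff havoid v]
    calc ∑ O ∈ tJoins G {e | ∀ w ∈ e, ¬ (fromEdgeSet ((↑B : Set (Sym2 V)) ∪ ↑I)).Reachable x w} ∅,
          Real.tanh β ^ #(I ∪ O) *
            isingCorr G (Finset.univ.filter fun v =>
              ¬ (fromEdgeSet ((↑B : Set (Sym2 V)) ∪ ↑(I ∪ O))).Reachable x v) β 0 .free {p, q}
        = ∑ O ∈ tJoins G {e | ∀ w ∈ e, ¬ (fromEdgeSet ((↑B : Set (Sym2 V)) ∪ ↑I)).Reachable x w} ∅,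
            Real.tanh β ^ #I * isingCorr G Λ β 0 .free {p, q} * Real.tanh β ^ #O := by
          refine Finset.sum_congr rfl fun O hO => ?_
          rw [hvol O hO, Finset.card_union_of_disjoint (idx_out_avoid_disjoint G B x hI hO).2, pow_add]
          ring
      _ = Real.tanh β ^ #I * isingCorr G Λ β 0 .free {p, q} * hteSum G Λ (Real.tanh β) ∅ := by
          rw [← Finset.mul_sum, sum_off_eq_hteSum G _ (fun v hv => absurd hv (Finset.notMem_empty v))]
      _ = Real.tanh β ^ #I * hteSum G Λ (Real.tanh β) {p, q} := by
          rw [isingCorr_free_eq_hteSum_div G Λ β hpqΛ, mul_assoc,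
            div_mul_cancel₀ _ (hteSum_empty_pos G Λ β).ne']
  rw [hL, hR]

end Assembly

end StubUnionShadowIdentity

open StubUnionShadowIdentity in
/-- **Registered stub `stub_unionShadowIdentity` of the line `union-shadow-exact`** (crux
stmt-CriticalPhenomena-14625): the EXACT union-shadow identity on every finite graph — for `F₂ ∈ 𝒯(a₂a₃)`
and an independent `F₁ ∈ 𝒯(a₀a₁)` resp. vacuum configuration `F₀ ∈ 𝒯(∅)`, the mass of the pairs in which
`a₀` is NOT joined to `a₂` equals the vacuum mass of the pairs whose union cluster `C⁺ ∋ a₂` misses `a₀, a₁`,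
weighted by the free two-point function `⟨σ_{a₀}σ_{a₁}⟩` of the depleted graph `G ∖ C⁺`
(loop-O(1) form of Aizenman–Duminil-Copin 2021, App. Lemma A.1).  Injectivity of `a` and `β ≥ 0` are not
needed. -/
theorem stub_unionShadowIdentity :
    ∀ (V : Type) [Fintype V] [DecidableEq V] (G : SimpleGraph V) [DecidableRel G.Adj] (β : ℝ),
      0 ≤ β → ∀ a : Fin 4 → V, Function.Injective a →
      (∑ F₁ ∈ tJoins G Set.univ {a 0, a 1}, ∑ F₂ ∈ tJoins G Set.univ {a 2, a 3},
          if (SimpleGraph.fromEdgeSet ((↑F₁ : Set (Sym2 V)) ∪ ↑F₂)).Reachable (a 0) (a 2) then (0 : ℝ)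
          else Real.tanh β ^ (F₁.card + F₂.card))
        =
      ∑ F₂ ∈ tJoins G Set.univ {a 2, a 3}, ∑ F₀ ∈ tJoins G Set.univ (∅ : Finset V),
          if ¬ (SimpleGraph.fromEdgeSet ((↑F₂ : Set (Sym2 V)) ∪ ↑F₀)).Reachable (a 2) (a 0) ∧
             ¬ (SimpleGraph.fromEdgeSet ((↑F₂ : Set (Sym2 V)) ∪ ↑F₀)).Reachable (a 2) (a 1)
          then Real.tanh β ^ (F₂.card + F₀.card) *
               isingCorr G (Finset.univ.filter (fun v : V =>
                 ¬ (SimpleGraph.fromEdgeSet ((↑F₂ : Set (Sym2 V)) ∪ ↑F₀)).Reachable (a 2) v)) β 0 .free {a 0, a 1}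
          else 0 := by
  intro V _ _ G _ β _ a _
  rw [Finset.sum_comm]
  refine Finset.sum_congr rfl fun F₂ hF₂ => ?_
  -- left inner sum as a filtered sum
  have eL : (∑ F₁ ∈ tJoins G Set.univ {a 0, a 1},
      if (fromEdgeSet ((↑F₁ : Set (Sym2 V)) ∪ ↑F₂)).Reachable (a 0) (a 2) then (0 : ℝ)
      else Real.tanh β ^ (#F₁ + #F₂)) =
      Real.tanh β ^ #F₂ * ∑ F ∈ (tJoins G Set.univ ({a 0, a 1} : Finset V)).filter
        (fun (F : Finset (Sym2 V)) => ∀ s ∈ ({a 0, a 1} : Finset V),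
          ¬ (fromEdgeSet ((↑F₂ : Set (Sym2 V)) ∪ ↑F)).Reachable (a 2) s), Real.tanh β ^ #F := by
    rw [Finset.mul_sum, Finset.sum_filter]
    refine Finset.sum_congr rfl fun F₁ hF₁ => ?_
    have hcomm : ((↑F₁ : Set (Sym2 V)) ∪ ↑F₂) = (↑F₂ ∪ ↑F₁) := Set.union_comm _ _
    by_cases hP : ∀ s ∈ ({a 0, a 1} : Finset V), ¬ (fromEdgeSet ((↑F₂ : Set (Sym2 V)) ∪ ↑F₁)).Reachable (a 2) s
    · have h0 : ¬ (fromEdgeSet ((↑F₁ : Set (Sym2 V)) ∪ ↑F₂)).Reachable (a 0) (a 2) := by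
        rw [hcomm]; exact fun h => hP (a 0) (by simp) h.symm
      rw [if_neg h0, if_pos hP, pow_add, mul_comm]
    · have h0 : (fromEdgeSet ((↑F₁ : Set (Sym2 V)) ∪ ↑F₂)).Reachable (a 0) (a 2) := by
        rw [hcomm]
        push Not at hP
        obtain ⟨s, hs, hrs⟩ := hP
        rw [Finset.mem_insert, Finset.mem_singleton] at hs
        rcases hs with rfl | rfl
        · exact hrs.symm
        · exact (reach_of_mem_tJoins_pair G F₂ hF₁).trans hrs.symm
      rw [if_pos h0, if_neg hP]
  -- right inner sum as a filtered sum
  have eR : (∑ F₀ ∈ tJoins G Set.univ (∅ : Finset V),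
      if ¬ (fromEdgeSet ((↑F₂ : Set (Sym2 V)) ∪ ↑F₀)).Reachable (a 2) (a 0) ∧
          ¬ (fromEdgeSet ((↑F₂ : Set (Sym2 V)) ∪ ↑F₀)).Reachable (a 2) (a 1)
      then Real.tanh β ^ (#F₂ + #F₀) *
          isingCorr G (Finset.univ.filter (fun v : V =>
            ¬ (fromEdgeSet ((↑F₂ : Set (Sym2 V)) ∪ ↑F₀)).Reachable (a 2) v)) β 0 .free {a 0, a 1}
      else 0) =
      Real.tanh β ^ #F₂ * ∑ F ∈ (tJoins G Set.univ (∅ : Finset V)).filter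
        (fun (F : Finset (Sym2 V)) => ∀ s ∈ ({a 0, a 1} : Finset V),
          ¬ (fromEdgeSet ((↑F₂ : Set (Sym2 V)) ∪ ↑F)).Reachable (a 2) s),
        Real.tanh β ^ #F *
          isingCorr G (Finset.univ.filter fun v =>
            ¬ (fromEdgeSet ((↑F₂ : Set (Sym2 V)) ∪ ↑F)).Reachable (a 2) v) β 0 .free {a 0, a 1} := by
    rw [Finset.mul_sum, Finset.sum_filter]
    refine Finset.sum_congr rfl fun F₀ _ => ?_
    have hiff : (∀ s ∈ ({a 0, a 1} : Finset V), ¬ (fromEdgeSet ((↑F₂ : Set (Sym2 V)) ∪ ↑F₀)).Reachable (a 2) s) ↔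
        (¬ (fromEdgeSet ((↑F₂ : Set (Sym2 V)) ∪ ↑F₀)).Reachable (a 2) (a 0) ∧
          ¬ (fromEdgeSet ((↑F₂ : Set (Sym2 V)) ∪ ↑F₀)).Reachable (a 2) (a 1)) := by
      simp only [Finset.mem_insert, Finset.mem_singleton, forall_eq_or_imp, forall_eq]
    by_cases hP : ∀ s ∈ ({a 0, a 1} : Finset V), ¬ (fromEdgeSet ((↑F₂ : Set (Sym2 V)) ∪ ↑F₀)).Reachable (a 2) s
    · rw [if_pos (hiff.1 hP), if_pos hP, pow_add]; ring
    · rw [if_neg (fun h => hP (hiff.2 h)), if_neg hP]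
  rw [eL, eR, pair_sum_eq_vacuum_sum G F₂ (a 2) β (a 0) (a 1)]

end Summit.CriticalPhenomena.Ising3DConformalLimit.Theorems

end
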